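import Summits.BirchSwinnertonDyer.BirchSwinnertonDyer.Theorems.PrintCFramBottomClassIndexLawFiveLeClassGroupChiRealisation
import Summits.BirchSwinnertonDyer.BirchSwinnertonDyer.Theorems.PrintCFramBottomClassIndexLawFiveLeSelmerCountLevelZeroRegistry
import Summits.BirchSwinnertonDyer.BirchSwinnertonDyer.Theorems.PrintCFramBottomClassIndexLawFiveLeSelmerCountLevelZeroIrregular
import Summits.BirchSwinnertonDyer.Rank1Residual.X11b.LocalPrimaryCohomologyEP
import HarnessLib

/-!
# Route `PrintCFram`, crux C2 `BottomClassIndexLawFiveLe` (stmt-BirchSwinnertonDyer-20372), line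
# `eisenstein-resource-bdp-line` (registry v24, arithmetic pair `stub_bsdp_of_level` / `stub_bsdp_of_sha_levelZero`): **THE B1-sha⁰ CENSUS AT ONE
# FIELD OF THE READER'S CHOICE** — EVEN-(IR)REGULARITY of a rank-one CM-ramified member is the same statement at every Galois
# realisation of `θ_e = ω ψ⁻¹` of degree prime to `p` (cell `bsd-print-cfram`, width seat `bsd-line-cfram-p1-w2` g12; helper
# `--supports` 20372; 0 defs, 0 facts, 0 sorry; CONDITIONAL exactly where its inputs are: CT + GZK on the `⟹` side (w4 g10 p683684);
# the `⟸` side is UNCONDITIONAL — w2 g11 p687909's binder `hEP` (Milne I 2.8) is discharged by the tree's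
# `Rank1Residual.X11b.LocBridge.localEulerPoincareCharacteristic_adicCompletionEP`, as in w7 g5's `…SelmerCountUnconditional`)

HONEST FRAMING. Nothing about BSD is proved here and no stub is closed; B1-level / B1-sha⁰ stay OPEN (LEAD g12/g13: promote). This file
only re-reads the two landed halves of the B1-sha⁰ census through the REALISATION INDEPENDENCE of `#e_χ(ℤ_p ⊗ Cl K)`
(`ClassGroupChiTower.classGroupChiCard_eq_of_absGaloisQuot_eq`, this seat): w4 g10's hypothesis `hEreg` («EVERY abelian realisation
`(K, χ)` of `ω ψ⁻¹` with `p ∤ [K:ℚ]` has `#e_χ(ℤ_p ⊗ Cl K) = 1`») and p687909 §3's hypothesis `hne` («`#e_{ω∘ψ̄}(ℤ_p ⊗ Cl K′) ≠ 1` at the CM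
reflection field `K′`») are now statements about ONE AND THE SAME number, readable at any Galois realisation of degree prime to `p`.

* §1 **`forall_classGroupChiCard_eq_one_of_one`** — regularity at ONE Galois realisation `(K₁, χ₁)` (`p ∤ [K₁:ℚ]`) of a `ℚ_p`-valued
  function `v` on `Γ_ℚ` ⟹ w4 g10's `hEreg` for `v`; `classGroupChiCard_ne_one_of_ne_one` — irregularity transfers likewise.
* §2 **`sha_noPTorsion_of_classGroupChiCard_eq_one_at`** — EVEN-REGULAR AT ONE REALISATION ⟹ `Ш(W)[p] = 0` (w4 g10's
  `sha_noPTorsion_of_evenRegularClassGroup` with `hEreg` so discharged; mod CT + GZK); **`classGroupChiCard_ne_one_at_of_sha_ne_zero`** —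
  `Ш(W)[p] ≠ 0` ⟹ EVERY Galois realisation of `ω ψ⁻¹` of degree prime to `p` is IRREGULAR (sharpens w2 g11's
  `exists_evenIrregular_realisation_of_sha_ne_zero`: «some» ↦ «every»).
* §3 **`exists_sha_ne_zero_of_level_zero_of_classGroupChiCard_ne_one_at`** — p687909 §3 (LEVEL 0 ∧ EVEN-IRREGULAR ⟹ `Ш(W)[p] ≠ 0`) with
  the irregularity hypothesis read at ANY Galois realisation `(K₂, χ₂)` of `ω∘ψ̄` with `p ∤ [K₂:ℚ]` instead of at `K′` itself.

NET (dossier B1-sha⁰, w2 g11 §5 (1) closed): for a rank-one CM-ramified member with a LEVEL-0 generator the dichotomy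
«`Ш(W)[p] = 0` (small Selmer, `BSD_p ⟺` Heegner `p`-primitivity) | `Ш(W)[p] ≠ 0` (premise of `stub_bsdp_of_sha_levelZero`)» is decided by
ONE class-group datum `#e_{θ̃_e}(ℤ_p ⊗ Cl K) ∈ {1, > 1}` at ANY Galois `K ∋` the values of `θ_e`, `p ∤ [K:ℚ]` — e.g. the real cyclic field
`ℚ̄^{ker θ_e}` of degree dividing `p − 1` (a finite computation per class). THEOREMS ONLY; no definition, no named fact, no `sorry`. BSD is
not proved by any of this; no summit statement is proved by this seat. References: [Washington1997] §10.2; [Lang1990] Ch. 13 §3 Lemma 1;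
[SilvermanAEC2009] X.§4; [MilneADT2006] I Thm. 2.8; [Cassels1962ArithmeticIV].
-/

set_option autoImplicit false
-- `…BirchSwinnertonDyer.BirchSwinnertonDyer.Theorems…` is the problem's mandated namespace (D-0017).
set_option linter.dupNamespace false

noncomputable section

open scoped Classical

namespace Summit.BirchSwinnertonDyer.BirchSwinnertonDyer.Theorems.PrintCFram.SelmerCount

open NumberField IsDedekindDomain Field WeierstrassCurve DirichletCharacter
open Literature.NumberTheory.NumberFields Literature.NumberTheory.EllipticCurves Literature.NumberTheory.GaloisRepresentations
  Literature.NumberTheory.EllipticCurves.Rank1Residual Literature.NumberTheory.EllipticCurves.KrizLi2019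
  Literature.NumberTheory.EllipticCurves.GreenbergSelmer
open Summit.BirchSwinnertonDyer.Rank1Residual.X2.ResidualDevissageModules
open Summit.BirchSwinnertonDyer.Rank1Residual.X11b.LocBridge (localEulerPoincareCharacteristic_adicCompletionEP)
open Summit.BirchSwinnertonDyer.BirchSwinnertonDyer.Theorems.PrintCFram.ClassGroupChiTower

variable {p : ℕ} [hp : Fact p.Prime]

/-! ## §1 One realisation decides all -/

/-- **Regularity at ONE Galois realisation gives w4 g10's `hEreg`.** Let `v : Γ_ℚ → ℚ_p` (meant: `τ ↦ ω(χ_p τ) ψ(χ_f τ)⁻¹`). If ONE number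
field `K₁` Galois over `ℚ` with `p ∤ [K₁:ℚ]` carries a character `χ₁ : Gal(K₁/ℚ) →* ℤ_pˣ` with values `v` on `Γ_ℚ` and
`#e_{χ₁}(ℤ_p ⊗ Cl K₁) = 1`, then EVERY abelian `K` with `p ∤ [K:ℚ]` and every `χ : Gal(K/ℚ) →* ℤ_pˣ` with values `v` has
`#e_χ(ℤ_p ⊗ Cl K) = 1` (realisation independence, `classGroupChiCard_eq_of_absGaloisQuot_eq`). [cite: Lang1990, Ch. 13 §3 Lemma 1 (PDF p. 201)]
[cite: Washington1997, §10.2] -/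
theorem forall_classGroupChiCard_eq_one_of_one (v : absoluteGaloisGroup ℚ → ℚ_[p])
    (K₁ : Type) [Field K₁] [NumberField K₁] [IsGalois ℚ K₁] (hp₁ : ¬ p ∣ Module.finrank ℚ K₁) (χ₁ : (K₁ ≃ₐ[ℚ] K₁) →* ℤ_[p]ˣ)
    (hχ₁ : ∀ τ : absoluteGaloisGroup ℚ, (((χ₁ (absGaloisQuot ℚ K₁ τ) : ℤ_[p]ˣ) : ℤ_[p]) : ℚ_[p]) = v τ)
    (h1 : classGroupChiCard ℚ K₁ p (fun g => ((χ₁ g : ℤ_[p]ˣ) : ℤ_[p])) = 1) :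
    ∀ (K : Type) [Field K] [NumberField K] [IsAbelianGalois ℚ K], ¬ p ∣ Module.finrank ℚ K →
      ∀ χ : (K ≃ₐ[ℚ] K) →* ℤ_[p]ˣ,
        (∀ τ : absoluteGaloisGroup ℚ, (((χ (absGaloisQuot ℚ K τ) : ℤ_[p]ˣ) : ℤ_[p]) : ℚ_[p]) = v τ) →
        classGroupChiCard ℚ K p (fun g => ((χ g : ℤ_[p]ˣ) : ℤ_[p])) = 1 := by
  intro K _ _ _ hpK χ hχ
  haveI : IsGalois ℚ K := IsAbelianGalois.toIsGalois
  rw [classGroupChiCard_eq_of_absGaloisQuot_eq p K K₁ hpK hp₁ χ χ₁ fun τ =>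
    Units.ext (PadicInt.ext ((hχ τ).trans (hχ₁ τ).symm)), h1]

/-- **Irregularity transfers between Galois realisations of degree prime to `p`.** [cite: Lang1990, Ch. 13 §3 Lemma 1 (PDF p. 201)]
[cite: Washington1997, §10.2] -/
theorem classGroupChiCard_ne_one_of_ne_one (K₁ K₂ : Type) [Field K₁] [NumberField K₁] [Field K₂] [NumberField K₂]
    [IsGalois ℚ K₁] [IsGalois ℚ K₂] (hp₁ : ¬ p ∣ Module.finrank ℚ K₁) (hp₂ : ¬ p ∣ Module.finrank ℚ K₂)
    (χ₁ : (K₁ ≃ₐ[ℚ] K₁) →* ℤ_[p]ˣ) (χ₂ : (K₂ ≃ₐ[ℚ] K₂) →* ℤ_[p]ˣ)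
    (h : ∀ τ : absoluteGaloisGroup ℚ, χ₁ (absGaloisQuot ℚ K₁ τ) = χ₂ (absGaloisQuot ℚ K₂ τ))
    (hne : classGroupChiCard ℚ K₁ p (fun g => ((χ₁ g : ℤ_[p]ˣ) : ℤ_[p])) ≠ 1) :
    classGroupChiCard ℚ K₂ p (fun g => ((χ₂ g : ℤ_[p]ˣ) : ℤ_[p])) ≠ 1 := by
  rwa [← classGroupChiCard_eq_of_absGaloisQuot_eq p K₁ K₂ hp₁ hp₂ χ₁ χ₂ h]

/-! ## §2 The `⟹` side at one field: EVEN-REGULAR AT ONE REALISATION ⟹ `Ш(W)[p] = 0`; `Ш(W)[p] ≠ 0` ⟹ IRREGULAR EVERYWHERE -/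

variable (W : WeierstrassCurve ℚ) [W.IsElliptic] [W.IsGloballyMinimal]

/-- **EVEN-REGULAR AT ONE GALOIS REALISATION ⟹ `Ш(W)[p] = 0`** (mod Cassels–Tate, GZK; `r_an = 1`). `W/ℚ` globally minimal with CM,
`p ≥ 5` CM-ramified, `(f, ψ, ω)` a Kriz–Li odd datum with the trace form `hss`, `v ∋ p`; ONE number field `K₁` Galois over `ℚ` with
`p ∤ [K₁:ℚ]` and ONE `χ₁ : Gal(K₁/ℚ) →* ℤ_pˣ` realising `ω ψ⁻¹` with `#e_{χ₁}(ℤ_p ⊗ Cl K₁) = 1`. Then `Ш(W/ℚ)` has no `p`-torsion. This is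
w4 g10's `sha_noPTorsion_of_evenRegularClassGroup` (p683684) with its hypothesis `hEreg` (ALL abelian realisations) discharged from one
realisation by §1. [cite: Washington1997, §10.2 (Thm. 10.9)] [cite: Cassels1962ArithmeticIV] -/
theorem sha_noPTorsion_of_classGroupChiCard_eq_one_at
    (hCT : exists_casselsTate_pairing (K := ℚ)) (hGZK : rank_eq_analyticRank_of_analyticRank_le_one)
    (hCM : W.HasCM) (hram : CMRamified W p) (h5 : 5 ≤ p) (hr : W.analyticRank = 1)
    {f : ℕ} [NeZero f] (ψ : DirichletCharacter ℚ_[p] f) (ω : DirichletCharacter ℚ_[p] p)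
    (hψ : ψ.Odd) (hω : IsTeichmullerCharacter ω)
    (hss : ∀ ℓ : ℕ, ℓ.Prime → ¬ (ℓ ∣ p * W.conductorNorm ℤ) →
      ‖((W.LFunction ℓ : ℤ) : ℚ_[p]) - (ψ (ℓ : ZMod f) + ψ⁻¹ (ℓ : ZMod f) * ω (ℓ : ZMod p))‖ < 1)
    (K₁ : Type) [Field K₁] [NumberField K₁] [IsGalois ℚ K₁] (hp₁ : ¬ p ∣ Module.finrank ℚ K₁) (χ₁ : (K₁ ≃ₐ[ℚ] K₁) →* ℤ_[p]ˣ)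
    (hχ₁ : ∀ τ : absoluteGaloisGroup ℚ, (((χ₁ (absGaloisQuot ℚ K₁ τ) : ℤ_[p]ˣ) : ℤ_[p]) : ℚ_[p]) =
      ω ((modNCyclotomicCharacter ℚ p τ : (ZMod p)ˣ) : ZMod p) * (ψ ((modNCyclotomicCharacter ℚ f τ : (ZMod f)ˣ) : ZMod f))⁻¹)
    (h1 : classGroupChiCard ℚ K₁ p (fun g => ((χ₁ g : ℤ_[p]ˣ) : ℤ_[p])) = 1)
    {v : HeightOneSpectrum (𝓞 ℚ)} (hpv : ((p : ℕ) : 𝓞 ℚ) ∈ v.asIdeal) :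
    ∀ x : W.sha, (p : ℤ) • x = 0 → x = 0 :=
  sha_noPTorsion_of_evenRegularClassGroup W hCT hGZK hCM hram h5 hr ψ ω hψ hω hss
    (fun K _ _ _ hpK χ hχ => forall_classGroupChiCard_eq_one_of_one _ K₁ hp₁ χ₁ hχ₁ h1 K hpK χ hχ) hpv

/-- **`Ш(W)[p] ≠ 0` ⟹ EVERY Galois realisation of `ω ψ⁻¹` of degree prime to `p` is class-group IRREGULAR** (mod Cassels–Tate, GZK):
contrapositive of `sha_noPTorsion_of_classGroupChiCard_eq_one_at`; sharpens w2 g11's `exists_evenIrregular_realisation_of_sha_ne_zero`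
(p688879: «SOME abelian realisation is irregular») to «ALL». So B1-sha⁰'s premise forces irregularity at whichever field the reader
computes in. [cite: Washington1997, §10.2 (Thm. 10.9)] [cite: Cassels1962ArithmeticIV] -/
theorem classGroupChiCard_ne_one_at_of_sha_ne_zero
    (hCT : exists_casselsTate_pairing (K := ℚ)) (hGZK : rank_eq_analyticRank_of_analyticRank_le_one)
    (hCM : W.HasCM) (hram : CMRamified W p) (h5 : 5 ≤ p) (hr : W.analyticRank = 1)
    {f : ℕ} [NeZero f] (ψ : DirichletCharacter ℚ_[p] f) (ω : DirichletCharacter ℚ_[p] p)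
    (hψ : ψ.Odd) (hω : IsTeichmullerCharacter ω)
    (hss : ∀ ℓ : ℕ, ℓ.Prime → ¬ (ℓ ∣ p * W.conductorNorm ℤ) →
      ‖((W.LFunction ℓ : ℤ) : ℚ_[p]) - (ψ (ℓ : ZMod f) + ψ⁻¹ (ℓ : ZMod f) * ω (ℓ : ZMod p))‖ < 1)
    {v : HeightOneSpectrum (𝓞 ℚ)} (hpv : ((p : ℕ) : 𝓞 ℚ) ∈ v.asIdeal)
    (hsha : ∃ s ∈ W.sha, s ≠ 0 ∧ p • s = 0)
    (K₁ : Type) [Field K₁] [NumberField K₁] [IsGalois ℚ K₁] (hp₁ : ¬ p ∣ Module.finrank ℚ K₁) (χ₁ : (K₁ ≃ₐ[ℚ] K₁) →* ℤ_[p]ˣ)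
    (hχ₁ : ∀ τ : absoluteGaloisGroup ℚ, (((χ₁ (absGaloisQuot ℚ K₁ τ) : ℤ_[p]ˣ) : ℤ_[p]) : ℚ_[p]) =
      ω ((modNCyclotomicCharacter ℚ p τ : (ZMod p)ˣ) : ZMod p) * (ψ ((modNCyclotomicCharacter ℚ f τ : (ZMod f)ˣ) : ZMod f))⁻¹) :
    classGroupChiCard ℚ K₁ p (fun g => ((χ₁ g : ℤ_[p]ˣ) : ℤ_[p])) ≠ 1 := by
  intro h1
  obtain ⟨s, hs, hs0, hps⟩ := hsha
  have h0 := sha_noPTorsion_of_classGroupChiCard_eq_one_at W hCT hGZK hCM hram h5 hr ψ ω hψ hω hss K₁ hp₁ χ₁ hχ₁ h1 hpv ⟨s, hs⟩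
    (Subtype.ext (by
      change (p : ℤ) • s = 0
      rw [natCast_zsmul]; exact hps))
  exact hs0 (congrArg Subtype.val h0)

/-! ## §3 The `⟸` side at one field: LEVEL 0 ∧ EVEN-IRREGULAR (at any realisation) ⟹ `Ш(W)[p] ≠ 0` (no named fact) -/

/-- **p687909 §3 with the irregularity read at ANY Galois realisation (and no named fact).** Hypotheses of
`exists_sha_ne_zero_of_level_zero_of_classGroupChiCard_ne_one_of_cmRamified` VERBATIM (class member of rank one, LEVEL `0`, odd line `Φ` with
character `θ`, CM reflection field `K ∋ ζ_p` Galois with `p ∤ [K:ℚ]` and `θ(res Γ_K) = 1`, descents `χ̄`, `ψ̄ = ā χ̄⁻¹ ≠ 1`), EXCEPT that (i) the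
EVEN-IRREGULARITY `#e_{ω∘ψ̄}(ℤ_p ⊗ Cl ·) ≠ 1` is supplied at an arbitrary number field `K₂` Galois over `ℚ` with `p ∤ [K₂:ℚ]` and a character
`χ₂ : Gal(K₂/ℚ) →* ℤ_pˣ` with the same values on `Γ_ℚ` as `ω∘ψ̄` (e.g. the real cyclic field cut out by `ω ψ̄`) — realisation independence moves
it to `K` —, and (ii) the binder `hEP` is discharged by the tree's `localEulerPoincareCharacteristic_adicCompletionEP` (as in w7 g5's
`…SelmerCountUnconditional`). Conclusion `∃ c ∈ Ш(W/ℚ), c ≠ 0 ∧ p • c = 0`. [cite: Washington1997, §10.2 (Thm. 10.9)]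
[cite: MilneADT2006, I Thm. 2.8] [cite: SilvermanAEC2009, X.§4] -/
theorem exists_sha_ne_zero_of_level_zero_of_classGroupChiCard_ne_one_at
    (hCM : W.HasCM) (hram : CMRamified W p) (h5 : 5 ≤ p)
    {v : HeightOneSpectrum (𝓞 ℚ)} (hpv : ((p : ℕ) : 𝓞 ℚ) ∈ v.asIdeal)
    (Φ : StableSubgroup (absoluteGaloisGroup ℚ) (geomTorsion W (p : ℤ))) (hcard : Nat.card Φ.Sub = p)
    (P : W.toAffine.Point)
    (hgen : ∀ R : W.toAffine.Point, ∃ (k : ℤ) (T : W.toAffine.Point), IsOfFinAddOrder T ∧ R = k • P + T)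
    (hlev : ∀ Q : (W.baseChange ℚ_[p]).toAffine.Point, p • Q ≠ W.toPadicPoint p P)
    (θ : absoluteGaloisGroup ℚ →* (ZMod p)ˣ)
    (hθ : ∀ (g : absoluteGaloisGroup ℚ) (s : Φ.Sub), g • s = (((θ g : ZMod p).val : ℕ) : ℤ) • s)
    {K : Type} [Field K] [NumberField K] [IsCMField K] [IsGalois ℚ K] (hpK : ¬ p ∣ Module.finrank ℚ K)
    (hrK : ∀ σ : absoluteGaloisGroup K, θ (absGaloisRestrict ℚ K σ) = 1)
    {ζ : K} (hζ : IsPrimitiveRoot ζ p) (a : (K ≃ₐ[ℚ] K) → ℕ) (ha : ∀ σ₀ : K ≃ₐ[ℚ] K, σ₀ ζ = ζ ^ a σ₀)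
    (χb : (K ≃ₐ[ℚ] K) →* (ZMod p)ˣ) (hχb : ∀ γ : absoluteGaloisGroup ℚ, χb (absGaloisQuot ℚ K γ) = θ γ)
    (hoddχ : χb ((IsCMField.complexConj K).restrictScalars ℚ) = -1)
    (ψb : (K ≃ₐ[ℚ] K) →* (ZMod p)ˣ) (hψb1 : ψb ≠ 1)
    (hψb : ∀ σ : K ≃ₐ[ℚ] K, ((ψb σ : (ZMod p)ˣ) : ZMod p) = (a σ : ZMod p) * (((χb σ)⁻¹ : (ZMod p)ˣ) : ZMod p))
    (K₂ : Type) [Field K₂] [NumberField K₂] [IsGalois ℚ K₂] (hp₂ : ¬ p ∣ Module.finrank ℚ K₂) (χ₂ : (K₂ ≃ₐ[ℚ] K₂) →* ℤ_[p]ˣ)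
    (hχ₂ : ∀ τ : absoluteGaloisGroup ℚ, χ₂ (absGaloisQuot ℚ K₂ τ) = (Kato2004.teichmullerChar p).comp ψb (absGaloisQuot ℚ K τ))
    (hne₂ : classGroupChiCard ℚ K₂ p (fun g => ((χ₂ g : ℤ_[p]ˣ) : ℤ_[p])) ≠ 1) :
    ∃ c ∈ W.sha, c ≠ 0 ∧ p • c = 0 :=
  exists_sha_ne_zero_of_level_zero_of_classGroupChiCard_ne_one_of_cmRamified W hCM hram h5 hpv
    (localEulerPoincareCharacteristic_adicCompletionEP ℚ v) Φ hcard P hgen hlev θ hθ hpK hrK hζ a ha χb hχb hoddχ ψb hψb1 hψb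
    (classGroupChiCard_ne_one_of_ne_one K₂ K hp₂ hpK χ₂ ((Kato2004.teichmullerChar p).comp ψb) hχ₂ hne₂)

end Summit.BirchSwinnertonDyer.BirchSwinnertonDyer.Theorems.PrintCFram.SelmerCount

end
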